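import Literature.Analysis.FluidPDE.EulerReynolds
import Literature.Analysis.FunctionSpaces.HolderNorm
import HarnessLib

/-!
# The Buckmaster–De Lellis–Székelyhidi–Vicol convex-integration scheme: the main iterative
# proposition and the time-regularity step (named facts)

Buckmaster–De Lellis–Székelyhidi–Vicol (BDSV), *Onsager's conjecture for admissible weak
solutions*, CPAM 72 (2019) = arXiv:1701.08678, prove Onsager flexibility (their Thm. 1.1, the
H21 fact `Turb.onsager_flexibility` of `Literature/Analysis/FluidPDE/Onsager.lean`) by reducing it
in §2.2 to an iterative **main proposition** (Prop. 2.1) on smooth solutions of the Euler–Reynolds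
system (`Torus.IsEulerReynoldsOn`, file `EulerReynolds.lean`), whose proof (mollification, gluing,
perturbation by Mikado flows; §§2.3–6 and the appendices) occupies the rest of the paper. This
file transcribes, for `T³ = UnitAddTorus (Fin 3)`:

* the parameters of the scheme (§2.1): the frequencies `λ_q = 2π ⌈a^{b^q}⌉` (`BDSV.freq a b q`)
  and amplitudes `δ_q = λ_q^{-2β}` (`BDSV.amp β a b q`);
* BDSV's sup-norm conventions (App. A "Hölder spaces": `‖f‖₀ = sup_{T³×[0,T]} |f|`,
  `[f]₁ = max_{|θ|=1} ‖D^θ f‖₀` with *spatial* derivatives only, `‖f‖₁ = ‖f‖₀ + [f]₁`) as the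
  bound predicates `BDSV.SupLE T f B` (`‖f‖₀ ≤ B`) and `BDSV.DerivSupLE T f B` (`[f]₁ ≤ B`);
* the hypotheses of Prop. 2.1: the normalised energy profile (`BDSV.IsNormalisedProfile`, a
  strictly positive smooth `e` on `[0,T]` with `sup |e'| ≤ 1`, the standing assumption (2.1) of
  §2.1) and the inductive estimates (`BDSV.InductiveEstimates`, the four displayed estimates of
  §2.1: `‖R̊_q‖₀ ≤ δ_{q+1} λ_q^{-3α}`, `‖v_q‖₁ ≤ M δ_q^{1/2} λ_q`, `‖v_q‖₀ ≤ 1 - δ_q^{1/2}`,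
  `δ_{q+1} λ_q^{-α} ≤ e(t) - ∫ |v_q|² ≤ δ_{q+1}`), and its extra conclusion
  `‖v_{q+1} - v_q‖₀ + λ_{q+1}^{-1} ‖v_{q+1} - v_q‖₁ ≤ M δ_{q+1}^{1/2}` (`BDSV.VelocityIncrementBound`);
* **named fact** `BDSV.mainIteration` = Prop. 2.1, with its exact quantifier structure
  (`∃ M` universal; `∀ β ∈ (0, 1/3)`, `∀ b ∈ (1, (1-β)/(2β))`; `∃ α₀(β, b)`; `∀ α ∈ (0, α₀)`;
  `∃ a₀(β, b, α, M)`; `∀ a ≥ a₀`; then for every `T`, profile and stage `q`);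
* **named fact** `BDSV.timeRegularity` = the time-regularity step of the proof of Thm. 1.1
  (§2.2, p. 6 of the arXiv version): the uniform limit of the velocities of the scheme, bounded in
  `C⁰_t C^{β'}_x`, is `C^{β''}` in space-time for every `β'' < β'`.

Both facts are `def … : Prop` (D-0014); the assembly "Prop. 2.1 ⇒ Thm. 1.1" (§2.2) is proved in
`Literature/Analysis/FluidPDE/OnsagerProofs.lean`.

## Design choices

* Norm bounds are predicates (`∀ t ∈ [0,T], ∀ x, ‖f t x‖ ≤ B`) rather than real-valued sups:
  for the smooth fields of the scheme on the compact `[0,T] × T³` these are equivalent to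
  `‖f‖₀ ≤ B`, and `‖f‖₁ ≤ B` is rendered as `∃ B₀ B₁, ‖f‖₀ ≤ B₀ ∧ [f]₁ ≤ B₁ ∧ B₀ + B₁ ≤ B`
  (equivalent, taking `B₀ = ‖f‖₀`, `B₁ = [f]₁`). Partial derivatives are `Torus.partialDeriv`, the
  pointwise norms are the Euclidean norm on `ℝ³` and, for the stress `R t x : Fin 3 → ℝ³`
  (columns), the maximal Euclidean column norm (see `EulerReynolds.lean`; BDSV fix no matrix
  norm, all being equivalent up to absolute constants absorbed in `M`, `α₀`, `a₀`).
* `a^{b^q}` is `Real.rpow a (b ^ q)`; `⌈·⌉` is `Int.ceil`, cast to `ℝ`; `δ_q^{1/2}` is `Real.sqrt`.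
* The universal constant is recorded as `∃ M, 0 < M ∧ …`: BDSV's `M = 64 M̄ ∑_{k ≠ 0} |k|^{-4}`
  (Def. 5.6, with `M̄ = C̄ c₀^{-1/2}` of Lemma 5.5) is positive.
* `e'` on the closed interval is the one-sided `derivWithin e (Icc 0 T)`.

## References

* T. Buckmaster, C. De Lellis, L. Székelyhidi Jr., V. Vicol, *Onsager's conjecture for admissible
  weak solutions*, Comm. Pure Appl. Math. 72 (2019) 229–274 = arXiv:1701.08678: §2.1 (parameters,
  inductive estimates, Prop. 2.1), §2.2 (proof of Thm. 1.1: normalisation, iteration, interpolation,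
  time regularity), Def. 5.6 (the constant `M`), App. A (Hölder norms).
* P. Isett, *Regularity in time along the coarse scale flow for the incompressible Euler
  equations*, arXiv:1307.0565 (the general time-regularity result BDSV point to).
* M. Colombo, L. De Rosa, *Regularity in time of Hölder solutions of Euler and hypodissipative
  Navier–Stokes equations*, SIAM J. Math. Anal. 52 (2020) 221–238, Thm. 1.1 (weak solutions in
  `L^∞_t C^θ_x`, `θ ∈ (0,1)`, are `C^θ` in space-time).
-/

open MeasureTheory Set Filter Topology
open scoped NNReal ENNReal ContDiff

noncomputable section

namespace Literature.Analysis.FluidPDE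

section Turb

namespace BDSV

/-- The flat three-torus `T³ = (ℝ/ℤ)³`, local notation. -/
local notation "𝕋³" => UnitAddTorus (Fin 3)

/-- Euclidean `ℝ³`, local notation. -/
local notation "ℝ³" => EuclideanSpace ℝ (Fin 3)

/-! ## Parameters of the scheme -/

section Parameters

/-- The frequency parameter `λ_q = 2π ⌈a^{b^q}⌉` of the BDSV scheme (§2.1), `a > 1` large,
`b > 1` close to `1`. [cite: BuckmasterEtAl2018, §2.1] -/
def freq (a b : ℝ) (q : ℕ) : ℝ :=
  2 * Real.pi * (⌈a ^ (b ^ q)⌉ : ℝ)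

/-- The amplitude parameter `δ_q = λ_q^{-2β}` of the BDSV scheme (§2.1), `0 < β < 1/3` the
target Hölder exponent. [cite: BuckmasterEtAl2018, §2.1] -/
def amp (β a b : ℝ) (q : ℕ) : ℝ :=
  freq a b q ^ (-2 * β)

/-- For `a ≥ 1` (indeed for `a ^ (b ^ q) > 0`), `λ_q ≥ 2π`. [folklore] -/
theorem two_pi_le_freq {a b : ℝ} (ha : 1 ≤ a) (q : ℕ) : 2 * Real.pi ≤ freq a b q := by
  unfold freq
  have h1 : (1 : ℝ) ≤ (⌈a ^ (b ^ q)⌉ : ℝ) := by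
    have hpos : 0 < a ^ (b ^ q) := Real.rpow_pos_of_pos (by linarith) _
    have : (1 : ℤ) ≤ ⌈a ^ (b ^ q)⌉ := Int.one_le_ceil_iff.2 hpos
    exact_mod_cast this
  nlinarith [Real.pi_pos]

/-- `λ_q > 0` for `a ≥ 1`. [folklore] -/
theorem freq_pos {a b : ℝ} (ha : 1 ≤ a) (q : ℕ) : 0 < freq a b q :=
  lt_of_lt_of_le (by positivity) (two_pi_le_freq ha q)

/-- `a^{b^q} ≤ λ_q / (2π)`, i.e. `2π a^{b^q} ≤ λ_q` (the elementary bound of §2.3). [cite: BuckmasterEtAl2018, §2.3] -/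
theorem two_pi_mul_rpow_le_freq (a b : ℝ) (q : ℕ) : 2 * Real.pi * a ^ (b ^ q) ≤ freq a b q := by
  unfold freq
  gcongr
  exact Int.le_ceil _

/-- `δ_q > 0` for `a ≥ 1`. [folklore] -/
theorem amp_pos {β a b : ℝ} (ha : 1 ≤ a) (q : ℕ) : 0 < amp β a b q :=
  Real.rpow_pos_of_pos (freq_pos ha q) _

/-- `δ_q ≤ 1` for `a ≥ 1` and `β ≥ 0` (since `λ_q ≥ 2π ≥ 1`). [folklore] -/
theorem amp_le_one {β a b : ℝ} (ha : 1 ≤ a) (hβ : 0 ≤ β) (q : ℕ) : amp β a b q ≤ 1 := by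
  unfold amp
  have h1 : (1 : ℝ) ≤ freq a b q :=
    le_trans (by nlinarith [Real.two_le_pi]) (two_pi_le_freq ha q)
  exact Real.rpow_le_one_of_one_le_of_nonpos h1 (by nlinarith)

end Parameters

/-! ## BDSV's sup norms as bound predicates -/

section Norms

variable {F : Type*} [NormedAddCommGroup F]

/-- `‖f‖₀ ≤ B` in BDSV's notation (App. A: `‖f‖₀ := sup_{T³ × [0,T]} |f|`): the field is bounded
by `B` on `[0,T] × T³`. [cite: BuckmasterEtAl2018, App. A (Hölder spaces)] -/
def SupLE (T : ℝ) (f : ℝ → 𝕋³ → F) (B : ℝ) : Prop :=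
  ∀ t ∈ Icc 0 T, ∀ x, ‖f t x‖ ≤ B

/-- `[f]₁ ≤ B` in BDSV's notation (App. A: `[f]₁ := max_{|θ|=1} ‖D^θ f‖₀`, spatial derivatives
only): every first spatial partial derivative of every time slice is bounded by `B` on
`[0,T] × T³`. [cite: BuckmasterEtAl2018, App. A (Hölder spaces)] -/
def DerivSupLE [NormedSpace ℝ F] (T : ℝ) (f : ℝ → 𝕋³ → F) (B : ℝ) : Prop :=
  ∀ i : Fin 3, ∀ t ∈ Icc 0 T, ∀ x, ‖FunctionSpaces.Torus.partialDeriv i (f t) x‖ ≤ B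

variable {T : ℝ} {f : ℝ → 𝕋³ → F} {B B' : ℝ}

/-- Monotonicity of the bound `‖f‖₀ ≤ B` in `B`. [folklore] -/
theorem SupLE.mono (h : SupLE T f B) (hB : B ≤ B') : SupLE T f B' :=
  fun t ht x => (h t ht x).trans hB

/-- Monotonicity of the bound `[f]₁ ≤ B` in `B`. [folklore] -/
theorem DerivSupLE.mono [NormedSpace ℝ F] (h : DerivSupLE T f B) (hB : B ≤ B') :
    DerivSupLE T f B' :=
  fun i t ht x => (h i t ht x).trans hB

/-- The zero field has `‖0‖₀ ≤ 0`. [folklore] -/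
theorem supLE_zero (T : ℝ) : SupLE T (fun (_ : ℝ) (_ : 𝕋³) => (0 : F)) 0 :=
  fun _ _ _ => by simp

/-- The zero field has `[0]₁ ≤ 0`. [folklore] -/
theorem derivSupLE_zero [NormedSpace ℝ F] (T : ℝ) :
    DerivSupLE T (fun (_ : ℝ) (_ : 𝕋³) => (0 : F)) 0 := by
  intro i t _ x
  have h : FunctionSpaces.Torus.partialDeriv i (fun _ : 𝕋³ => (0 : F)) x = 0 := by
    unfold FunctionSpaces.Torus.partialDeriv FunctionSpaces.Torus.lineDeriv
    simp
  rw [h, norm_zero]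

end Norms

/-! ## Hypotheses and conclusions of the main proposition -/

section Hypotheses

/-- The energy profiles admitted in Prop. 2.1: `e : [0,T] → ℝ` smooth (`C^∞` on `[0,T]`) and
strictly positive, normalised by the standing assumption (2.1) of §2.1,
`sup_{t ∈ [0,T]} |e'(t)| ≤ 1` (one-sided derivative within `[0,T]`); BDSV, §2.2, reduce a general
profile to this case by scaling. [cite: BuckmasterEtAl2018, §2.1 (2.1)] -/
structure IsNormalisedProfile (T : ℝ) (e : ℝ → ℝ) : Prop where
  /-- `e` is smooth on `[0,T]`. -/
  smooth : ContDiffOn ℝ ∞ e (Icc 0 T)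
  /-- `e` is strictly positive on `[0,T]`. -/
  pos : ∀ t ∈ Icc 0 T, 0 < e t
  /-- `|e'| ≤ 1` on `[0,T]`. -/
  abs_deriv_le : ∀ t ∈ Icc 0 T, |derivWithin e (Icc 0 T) t| ≤ 1

/-- The inductive estimates of the BDSV scheme at stage `q` for the velocity `v = v_q` and the
stress `R = R̊_q`, relative to the energy profile `e` and the parameters `M, β, α, a, b` (§2.1, the
four displayed estimates preceding Prop. 2.1):
`‖R̊_q‖₀ ≤ δ_{q+1} λ_q^{-3α}`, `‖v_q‖₁ ≤ M δ_q^{1/2} λ_q` (with `‖·‖₁ = ‖·‖₀ + [·]₁`),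
`‖v_q‖₀ ≤ 1 - δ_q^{1/2}`, and `δ_{q+1} λ_q^{-α} ≤ e(t) - ∫_{T³} |v_q(x,t)|² dx ≤ δ_{q+1}` for all
`t ∈ [0,T]`. [cite: BuckmasterEtAl2018, §2.1] -/
structure InductiveEstimates (M β α a b T : ℝ) (e : ℝ → ℝ) (q : ℕ) (v : ℝ → 𝕋³ → ℝ³)
    (R : ℝ → 𝕋³ → Fin 3 → ℝ³) : Prop where
  /-- `‖R̊_q‖₀ ≤ δ_{q+1} λ_q^{-3α}`. -/
  stress_le : SupLE T R (amp β a b (q + 1) * freq a b q ^ (-3 * α))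
  /-- `‖v_q‖₁ = ‖v_q‖₀ + [v_q]₁ ≤ M δ_q^{1/2} λ_q`. -/
  velocity_C1_le : ∃ B₀ B₁ : ℝ, SupLE T v B₀ ∧ DerivSupLE T v B₁ ∧
    B₀ + B₁ ≤ M * Real.sqrt (amp β a b q) * freq a b q
  /-- `‖v_q‖₀ ≤ 1 - δ_q^{1/2}`. -/
  velocity_le : SupLE T v (1 - Real.sqrt (amp β a b q))
  /-- `δ_{q+1} λ_q^{-α} ≤ e(t) - ∫ |v_q(t)|²` on `[0,T]`. -/
  energy_ge : ∀ t ∈ Icc 0 T, amp β a b (q + 1) * freq a b q ^ (-α) ≤ e t - ∫ x, ‖v t x‖ ^ 2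
  /-- `e(t) - ∫ |v_q(t)|² ≤ δ_{q+1}` on `[0,T]`. -/
  energy_le : ∀ t ∈ Icc 0 T, e t - ∫ x, ‖v t x‖ ^ 2 ≤ amp β a b (q + 1)

/-- The velocity-increment estimate of Prop. 2.1 for `w = v_{q+1} - v_q`:
`‖w‖₀ + λ_{q+1}^{-1} ‖w‖₁ ≤ M δ_{q+1}^{1/2}` with `‖w‖₁ = ‖w‖₀ + [w]₁` (the last display of
Prop. 2.1). [cite: BuckmasterEtAl2018, Prop. 2.1] -/
def VelocityIncrementBound (M β a b T : ℝ) (q : ℕ) (w : ℝ → 𝕋³ → ℝ³) : Prop :=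
  ∃ B₀ B₁ : ℝ, SupLE T w B₀ ∧ DerivSupLE T w B₁ ∧
    B₀ + (freq a b (q + 1))⁻¹ * (B₀ + B₁) ≤ M * Real.sqrt (amp β a b (q + 1))

end Hypotheses

/-! ## The two named facts -/

section Facts

/-- **BDSV main iterative proposition** (Buckmaster–De Lellis–Székelyhidi–Vicol 2019,
Prop. 2.1, verbatim structure): "There is a universal constant `M` with the following property.
Assume `0 < β < 1/3` and `1 < b < (1-β)/(2β)`. Then there exists an `α₀` depending on `β` and
`b`, such that for any `0 < α < α₀` there exists an `a₀` depending on `β, b, α` and `M`, such that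
for any `a ≥ a₀` the following holds: Given a strictly positive energy function `e : [0,T] → ℝ`
satisfying `sup_t |e'(t)| ≤ 1`, and a triple `(v_q, R̊_q, p_q)` solving the Euler–Reynolds system
(with `tr R̊_q = 0`, `∫ p_q = 0`) and satisfying the inductive estimates, then there exists a
solution `(v_{q+1}, R̊_{q+1}, p_{q+1})` to the same system satisfying the inductive estimates with
`q` replaced by `q+1`. Moreover `‖v_{q+1} - v_q‖₀ + λ_{q+1}^{-1} ‖v_{q+1} - v_q‖₁ ≤ M δ_{q+1}^{1/2}`."
Transcription: triples are `Torus.IsEulerReynoldsOn (Icc 0 T)` (smooth on `[0,T] × T³`,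
classical), estimates are `BDSV.InductiveEstimates` / `BDSV.VelocityIncrementBound`, the profile is
`BDSV.IsNormalisedProfile`; `0 < T` is explicit; `0 < M` (Def. 5.6) and `1 < a₀` ("`a > 1` is a
large parameter", §2.1) are recorded in the existentials. [cite: BuckmasterEtAl2018, Prop. 2.1] -/
def mainIteration : Prop :=
  ∃ M : ℝ, 0 < M ∧
    ∀ β : ℝ, 0 < β → β < 1 / 3 → ∀ b : ℝ, 1 < b → b < (1 - β) / (2 * β) →
      ∃ α₀ : ℝ, 0 < α₀ ∧ ∀ α : ℝ, 0 < α → α < α₀ →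
        ∃ a₀ : ℝ, 1 < a₀ ∧ ∀ a : ℝ, a₀ ≤ a →
          ∀ T : ℝ, 0 < T → ∀ e : ℝ → ℝ, IsNormalisedProfile T e →
            ∀ (q : ℕ) (v : ℝ → 𝕋³ → ℝ³) (p : ℝ → 𝕋³ → ℝ) (R : ℝ → 𝕋³ → Fin 3 → ℝ³),
              Torus.IsEulerReynoldsOn (Icc 0 T) v p R →
              InductiveEstimates M β α a b T e q v R →
                ∃ (v' : ℝ → 𝕋³ → ℝ³) (p' : ℝ → 𝕋³ → ℝ) (R' : ℝ → 𝕋³ → Fin 3 → ℝ³),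
                  Torus.IsEulerReynoldsOn (Icc 0 T) v' p' R' ∧
                  InductiveEstimates M β α a b T e (q + 1) v' R' ∧
                  VelocityIncrementBound M β a b T q (fun t x => v' t x - v t x)

/-- **BDSV time-regularity step** (Buckmaster–De Lellis–Székelyhidi–Vicol 2019, §2.2, proof of
Thm. 1.1, p. 6 of arXiv:1701.08678). In the proof of Thm. 1.1 the velocities `v_q` of the
Euler–Reynolds triples produced by Prop. 2.1 converge uniformly on `[0,T] × T³` to `v`, with
`‖R̊_q‖₀ → 0` and `(v_q)` "uniformly bounded in `C⁰_t C^{β'}_x`"; BDSV then show ("To recover the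
time regularity, we could use the Euler equations and the general result in [Isett,
arXiv:1307.0565]. Nevertheless ... the following short and self-contained proof": spatial
mollification `ṽ_q = v * ψ_{2^{-q}}`, Schauder estimates for `∇p * ψ_{2^{-q}}` from
`-Δp = div div (v ⊗ v)`, and interpolation in time) that `v ∈ C^{β''}([0,T] × T³)` for every
`β'' < β'`. Transcription: for classical Euler–Reynolds solutions `(v_q, p_q, R_q)` on
`[0,T] × T³` (`Torus.IsEulerReynoldsOn (Icc 0 T)`), `0 < T`, with `v_q → u` uniformly on
`[0,T] × T³`, `‖R_q‖₀ → 0`, and the slices `v_q(t)`, `t ∈ [0,T]`, `β'`-Hölder on `T³` with a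
constant independent of `q, t`, where `0 < β' < 1/3` as in the source (`β' < β < 1/3`), the
limit `u` is `β''`-Hölder on `[0,T] × T³` (`Literature.HolderOnSpaceTime β'' T u`, product sup-metric)
for every `β'' < β'`. The same conclusion with `β'' = β'` (and any `β' ∈ (0,1)`) is
Colombo–De Rosa 2020, Thm. 1.1 (weak solutions in `L^∞_t C^θ_x`), first proved by Isett
(arXiv:1307.0565). [cite: BuckmasterEtAl2018, §2.2 (proof of Thm. 1.1, time regularity)] -/
def timeRegularity : Prop :=
  ∀ (T : ℝ), 0 < T → ∀ (β' : ℝ≥0), 0 < β' → β' < 1 / 3 →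
    ∀ (v : ℕ → ℝ → 𝕋³ → ℝ³) (p : ℕ → ℝ → 𝕋³ → ℝ) (R : ℕ → ℝ → 𝕋³ → Fin 3 → ℝ³)
      (u : ℝ → 𝕋³ → ℝ³),
      (∀ q, Torus.IsEulerReynoldsOn (Icc 0 T) (v q) (p q) (R q)) →
      (∀ ε > 0, ∃ N : ℕ, ∀ q ≥ N, ∀ t ∈ Icc 0 T, ∀ x, ‖v q t x - u t x‖ ≤ ε) →
      (∀ ε > 0, ∃ N : ℕ, ∀ q ≥ N, ∀ t ∈ Icc 0 T, ∀ x, ‖R q t x‖ ≤ ε) →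
      (∃ C : ℝ≥0, ∀ q, ∀ t ∈ Icc 0 T, HolderWith C β' (v q t)) →
        ∀ β'' : ℝ≥0, β'' < β' → FunctionSpaces.HolderOnSpaceTime β'' T u

end Facts

end BDSV

end Turb

end Literature.Analysis.FluidPDE
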